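import Summits.BirchSwinnertonDyer.BirchSwinnertonDyer.Theses.ErratumRoadFive
import Summits.BirchSwinnertonDyer.BirchSwinnertonDyer.Theorems.ErratumRoadFiveErratumThm23DecOfTwoVarCore
import Summits.BirchSwinnertonDyer.BirchSwinnertonDyer.Theorems.ErratumRoadFiveTwoVariableControlFiniteDefect
import Summits.BirchSwinnertonDyer.BirchSwinnertonDyer.Theorems.BiquadraticEisensteinDescentEisensteinHeartFlatCMInertBadKPrimeCharIdealBaseChange
import Literature.NumberTheory.EllipticCurves.PadicCoeffIntegersFrobeniusData
import HarnessLib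

/-!
# Crux `ErratumThm23SigmaLe` (stmt-BirchSwinnertonDyer-25505, F4♯) from the two-variable core (S1) and the FINITENESS of
# the LOCAL control defect at `𝔭̄` on the anomalous corner (S2♭♭) — composition of the v4 line `erratum_chain` as a THEOREM
# (helper, `--supports stmt-BirchSwinnertonDyer-25505`)

Cell `bsd-stepL`, seat `bsd-stepL-imc-p1` (prover g22, 2026-08-28). Theorems only (no definition, no named fact, no
`sorry`, no instance, no notation). Sequel of p631770 (v3 composition), p634294 (F4♯ on (dec) from S1) and the finite-defect
control chain p636684 (`ControlDualFinite`), `SelmerTorsionControlFinite`, `TwoVariableControlFiniteDefect` (g22).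

## What this file proves and why

`erratumThm23SigmaLe_of_twoVarCore_of_localDefect (hFW : ‹S1 verbatim›) (hLoc : ‹S2♭♭›) : Theses.ErratumRoadFive.ErratumThm23SigmaLe`
where S2♭♭ (v4 stub `stub_localDefectFiniteAnomalous`) is the purely LOCAL statement: on the corner `¬(dec)` (the newform has
a non-zero `Γ_{K_𝔭̄}`-fixed `p`-power-torsion element in `A_g`, i.e. `a_p(g) ≡ 1 (mod ϖ)` and `ρ̄_g|_{G_{ℚ_p}}` split), for a
cyclotomic `κ'`, the control defect at the strict prime — the `T_c`-cotorsion `𝓜^{Γ_{K_𝔭̄}}/T_c 𝓜^{Γ_{K_𝔭̄}}` of the local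
invariants of the two-variable big representation `𝓜 = A_g ⊗ Λ_K^*` — is FINITE. Everything else is the tree's:
(dec) case = p634294 (EXACT control); `¬(dec)` case = (glob) from irreducibility (`IrrK…'`), (unr), a cyclotomic `κ'`,
`ControlFiniteDefect.module_finite_XBig_iterate_of_finite_defect` ∕ `exists_controlMap_of_finite_defect` (surjection
`X^Σ_K/T_c ↠ X^Σ_ac` with FINITE kernel, [JSW17 L.3.4.1] general case), a finite `Λ_𝒪`-module is pseudo-null (`𝒪` a DVR:
tree `…CharIdealBaseChange.isPseudoNull_of_finite`, with the DVR structure transported from the unit ball), and the S1-fed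
descent [JSW17 Cor. 3.4.2] (`TwoVariableDescent.*`, pseudo-null kernel).

S2♭♭ is TRUE on the whole corner (memo `HOME/imc-p1/g22/CORNER-25505-imc-p1-g22.md` §2.4: `ker κ_ac ∩ I_𝔭̄ = 1` in `Γ_K`, so
the cyclotomic variable moves the unramified unit-root line of `A_g^{G_{K_{∞,𝔭̄}}}` by a 1-unit `≠ 1`, and `(β − 1)` is onto the
divisible part); its kernel proof wants Frobenius-at-`p` semantics ([Wiles88 Thm. 2], [Deligne]) and that CFT fact as named
facts — typer-first. [JSW17]'s own sentence «`𝓜^{G_{K_v}}` has finite order» (p. 14) is false on the locally-split part of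
the corner; the FINITENESS OF THE QUOTIENT, which is all Lemma 3.4.1 needs, is what S2♭♭ states.

HONEST FRAMING: CONDITIONAL on its two displayed hypotheses (S1 OPEN; S2♭♭ not yet in the kernel); closes nothing by itself;
BSD is proved for no pair; closes: none (T7).

[claim: FouquetWan2021, Thm. 4.41, App. B Cor. 7.21, Lemma 7.22, status: under-review] [claim: Castella2018Erratum, Thm. 2.3, status: under-review]
[cite: JetchevSkinnerWan2017, §3.4, Lemma 3.4.1, Cor. 3.4.2 (arXiv:1512.06894 p. 14)] [cite: Castella2018Erratum, Lemma 2.1 (p. 2)]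
-/

noncomputable section

open scoped Classical

open PowerSeries NumberField IsDedekindDomain Field
  Literature.NumberTheory.EllipticCurves Literature.NumberTheory.EllipticCurves.ModularForms
  Literature.NumberTheory.EllipticCurves.BigGaloisRep Literature.NumberTheory.EllipticCurves.GreenbergSelmer
  Literature.NumberTheory.GaloisRepresentations

-- D-0017: single-problem summit, the namespace repeats the problem name by design.
set_option linter.dupNamespace false
set_option autoImplicit false

namespace Summit.BirchSwinnertonDyer.BirchSwinnertonDyer.Theorems.ErratumThm23TwoVariable.ErratumChainV4

/-- **`𝒪 = padicCoeffIntegers ι_g` is a discrete valuation ring** for a newform `g` (transported from the unit ball of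
`ℚ_p(ι_g K_g)`, a finite extension of `ℚ_p`, along `GreenbergSelmer.exists_ringEquiv_unitBall`). [cite: SerreLocalFields1979, Ch. II §2, Prop. 3] -/
theorem isDiscreteValuationRing_padicCoeffIntegers {p : ℕ} [Fact p.Prime] {M : ℕ} [NeZero M] {k : ℤ}
    {g : CuspForm (CongruenceSubgroup.Gamma0 M) k} (ιg : coeffField g →+* PadicAlgCl p) (hnf : IsNewform0 g) :
    IsDiscreteValuationRing (padicCoeffIntegers ιg) := by
  haveI := CoeffRing.finiteDimensional_padicCoeffField ιg hnf
  haveI := CoeffRing.isDiscreteValuationRing_unitBall (p := p) (padicCoeffField ιg)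
  obtain ⟨e, -, -⟩ := GreenbergSelmer.exists_ringEquiv_unitBall ιg
  exact IsDiscreteValuationRing.RingEquivClass.isDiscreteValuationRing e.symm

/-- **A finite `Λ_𝒪`-module is pseudo-null**, `𝒪 = padicCoeffIntegers ι_g` of a newform (tree
`…CharIdealBaseChange.isPseudoNull_of_finite` for a DVR `𝒪`). [cite: NeukirchSchmidtWingberg2008, Ch. V §1, (5.1.4) Remark 4] -/
theorem isPseudoNull_of_finite_coeffRing {p : ℕ} [Fact p.Prime] {M : ℕ} [NeZero M] {k : ℤ}
    {g : CuspForm (CongruenceSubgroup.Gamma0 M) k} (ιg : coeffField g →+* PadicAlgCl p) (hnf : IsNewform0 g)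
    (N : Type*) [AddCommGroup N] [_root_.Module (PowerSeries (padicCoeffIntegers ιg)) N] [Finite N] :
    Literature.NumberTheory.EllipticCurves.Module.IsPseudoNull (PowerSeries (padicCoeffIntegers ιg)) N := by
  haveI := isDiscreteValuationRing_padicCoeffIntegers ιg hnf
  exact BiquadraticEisensteinDescentEisensteinHeartFlatCMInertBadKPrimeCharIdealBaseChange.isPseudoNull_of_finite

set_option maxHeartbeats 800000 in
-- statement-sized packages over the iterated big representation (as p631770 ∕ p634294); the proof is glue
/-- **F4♯ from the two-variable core (S1) and the finiteness of the local control defect on the anomalous corner (S2♭♭)** —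
the composition `ErratumThm23SigmaLe_of` of the proposed v4 line `erratum_chain`: on (dec) p634294 (exact control); on `¬(dec)`
finite-defect control (`ControlFiniteDefect.*`) from S2♭♭, a finite kernel is pseudo-null over `Λ_𝒪`, and the S1-fed descent
[JSW17, Cor. 3.4.2]. [cite: Castella2018Erratum, §2, proof of Thm. 2.3: (2.4) ⇒ (2.5) (p. 4)]
[cite: JetchevSkinnerWan2017, §3.4, Lemma 3.4.1 and Cor. 3.4.2 (arXiv:1512.06894 p. 14)] -/
theorem erratumThm23SigmaLe_of_twoVarCore_of_localDefect
    (hFW :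
      ∀ {p : ℕ} [Fact p.Prime] (ι : PadicAlgCl p ≃+* ℂ) {M : ℕ} [NeZero M] {k : ℤ}
        (g : CuspForm (CongruenceSubgroup.Gamma0 M) k) (ιg : coeffField g →+* PadicAlgCl p)
        (Δ : OrdinaryNewformDatum g p ιg)
        (K : Type) [Field K] [NumberField K] (𝔭 𝔭bar : HeightOneSpectrum (𝓞 K)) (κ : ZpExtension K p)
        (γ : absoluteGaloisGroup K) [Fact (κ.IsTopGenerator γ)] (S : Finset (HeightOneSpectrum (𝓞 K))),
        IsNewform0 g → 2 ≤ k → Even k → 3 ≤ M → ¬ p ∣ M → 3 < p →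
        (∀ x : coeffField g, ι (ιg x) = (x : ℂ)) →
        ‖ιg ⟨(UpperHalfPlane.qExpansion 1 ⇑g).coeff p, coeff_mem_coeffField g p⟩‖ = 1 →
        IsImaginaryQuadratic K → (∃ β : ℤ, (4 * M : ℤ) ∣ β ^ 2 - NumberField.discr K) →
        ((Ideal.span {(p : ℤ)}).primesOver (𝓞 K)).ncard = 2 →
        ((p : ℕ) : 𝓞 K) ∈ 𝔭.asIdeal →
        (∀ (w : InfinitePlace K) (x : 𝓞 K), x ∈ 𝔭.asIdeal ↔ ‖ι.symm (w.embedding (x : K))‖ < 1) →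
        ((p : ℕ) : 𝓞 K) ∈ 𝔭bar.asIdeal → 𝔭bar ≠ 𝔭 →
        SkinnerUrban2014.IsResiduallyIrreducible Δ →
        (∃ v : HeightOneSpectrum (𝓞 ℚ), SkinnerUrban2014.IsResiduallyRamifiedAt Δ v ∧
          ((Rat.HeightOneSpectrum.primesEquiv v : Nat.Primes) : ℕ) ∣ M ∧
          ¬ ((Rat.HeightOneSpectrum.primesEquiv v : Nat.Primes) : ℕ) ^ 2 ∣ M ∧
          ((Ideal.span {(((Rat.HeightOneSpectrum.primesEquiv v : Nat.Primes) : ℕ) : ℤ)}).primesOver (𝓞 K)).ncard ≠ 2) →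
        (((Ideal.span {(2 : ℤ)}).primesOver (𝓞 K)).ncard ≠ 2 → (2 ∣ M ∧ ¬ 4 ∣ M)) →
        (∀ ℓ : ℕ, ℓ.Prime → ℓ ∣ M → ((Ideal.span {(ℓ : ℤ)}).primesOver (𝓞 K)).ncard ≠ 2 →
          ¬ ℓ ^ 2 ∣ M ∧ (UpperHalfPlane.qExpansion 1 ⇑g).coeff ℓ = -((ℓ : ℂ) ^ (k / 2 - 1).toNat)) →
        κ.IsAnticyclotomic → (∀ w ∈ S, ((p : ℕ) : 𝓞 K) ∉ w.asIdeal) →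
        (∀ w : HeightOneSpectrum (𝓞 K), ((M : ℕ) : 𝓞 K) ∈ w.asIdeal → w ∈ S) →
        ∀ (b : padicCoeffIntegers ιg →+* PadicComplexInt p),
          (∀ x, ((b x : PadicComplexInt p) : ℂ_[p]) =
            algebraMap (PadicAlgCl p) ℂ_[p] (padicCoeffIntegers.toPadicAlgCl ιg x)) →
        ∀ (ΩK : ℂ) (Ωp : (PadicComplexInt p)ˣ) (Q : PowerSeries (PadicComplexInt p)), ΩK ≠ 0 →
          IsBDPLFunctionWtSigmaInt ι 𝔭 κ γ g S ΩK ((Ωp : PadicComplexInt p) : ℂ_[p]) Q →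
        -- the complementary (cyclotomic) direction `κ'` with generator `γ'`: `Γ_K = Γ⁺ ⊕ Γ⁻ ≅ ℤ_p²` for `p` odd
        ∀ (κ' : ZpExtension K p) (γ' : absoluteGaloisGroup K) [Fact (κ'.IsTopGenerator γ')], κ'.IsCyclotomic →
        ∀ [TopologicalSpace (PowerSeries (padicCoeffIntegers ιg))]
          [TopologicalSpace (PowerSeries (PowerSeries (padicCoeffIntegers ιg)))]
          [ContinuousSMul (PowerSeries (PowerSeries (padicCoeffIntegers ιg)))
            (BigRepModule (PowerSeries (padicCoeffIntegers ιg)) p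
              (BigRepModule (padicCoeffIntegers ιg) p (Cofree Δ.ρ (padicCoeffField ιg))))],
        -- premise: `X^Σ_K(A_g)` is `Λ_K`-torsion; conclusion: a two-variable frame pinned to `Q` on `X = 0` dividing `Ch_{Λ_K}(X^Σ_K(A_g))`
        Module.IsTorsion (PowerSeries (PowerSeries (padicCoeffIntegers ιg)))
            (XBig κ' (AnticyclotomicBigGaloisRep κ (Δ.cofreeRepOver K)) 𝔭bar (↑S)) →
        ∃ Q₂ : PowerSeries (PowerSeries (PadicComplexInt p)),
          (∃ u : (PowerSeries (PadicComplexInt p))ˣ,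
              PowerSeries.constantCoeff Q₂ = (u : PowerSeries (PadicComplexInt p)) * Q) ∧
          (XBig.charIdeal κ' (AnticyclotomicBigGaloisRep κ (Δ.cofreeRepOver K)) 𝔭bar (↑S)).map
              (PowerSeries.map (PowerSeries.map b)) ≤ Ideal.span {Q₂})
    (hLoc :
      ∀ {p : ℕ} [Fact p.Prime] {M : ℕ} [NeZero M] {k : ℤ}
        (g : CuspForm (CongruenceSubgroup.Gamma0 M) k) (ιg : coeffField g →+* PadicAlgCl p)
        (Δ : OrdinaryNewformDatum g p ιg)
        (K : Type) [Field K] [NumberField K] (𝔭bar : HeightOneSpectrum (𝓞 K)) (κ : ZpExtension K p)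
        (γ : absoluteGaloisGroup K) [Fact (κ.IsTopGenerator γ)] (S : Finset (HeightOneSpectrum (𝓞 K))),
        IsNewform0 g → 2 ≤ k → Even k → ¬ p ∣ M → 3 < p →
        ‖ιg ⟨(UpperHalfPlane.qExpansion 1 ⇑g).coeff p, coeff_mem_coeffField g p⟩‖ = 1 →
        IsImaginaryQuadratic K → ((Ideal.span {(p : ℤ)}).primesOver (𝓞 K)).ncard = 2 →
        ((p : ℕ) : 𝓞 K) ∈ 𝔭bar.asIdeal →
        SkinnerUrban2014.IsResiduallyIrreducible Δ →
        (∃ v : HeightOneSpectrum (𝓞 ℚ), SkinnerUrban2014.IsResiduallyRamifiedAt Δ v ∧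
          ((Rat.HeightOneSpectrum.primesEquiv v : Nat.Primes) : ℕ) ∣ M ∧
          ¬ ((Rat.HeightOneSpectrum.primesEquiv v : Nat.Primes) : ℕ) ^ 2 ∣ M ∧
          ((Ideal.span {(((Rat.HeightOneSpectrum.primesEquiv v : Nat.Primes) : ℕ) : ℤ)}).primesOver (𝓞 K)).ncard ≠ 2) →
        κ.IsAnticyclotomic → (∀ w ∈ S, ((p : ℕ) : 𝓞 K) ∉ w.asIdeal) →
        (∀ w : HeightOneSpectrum (𝓞 K), ((M : ℕ) : 𝓞 K) ∈ w.asIdeal → w ∈ S) →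
        -- the corner `¬(dec)`: a non-zero `Γ_{K_𝔭̄}`-fixed `p`-power-torsion element of `A_g` ("anomalous at `𝔭̄`")
        ¬ (∀ a : Cofree Δ.ρ (padicCoeffField ιg),
            (∀ σ : LocalGroup K (Sum.inl 𝔭bar), (Δ.cofreeRepOver K) (localMap K (Sum.inl 𝔭bar) σ) a = a) →
            (∃ j : ℕ, p ^ j • a = 0) → a = 0) →
        -- the complementary CYCLOTOMIC direction `κ'` with a generator `γ'`
        ∀ (κ' : ZpExtension K p) (γ' : absoluteGaloisGroup K) [Fact (κ'.IsTopGenerator γ')], κ'.IsCyclotomic →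
        ∀ [TopologicalSpace (PowerSeries (padicCoeffIntegers ιg))]
          [ContinuousSMul (PowerSeries (padicCoeffIntegers ιg))
            (BigRepModule (padicCoeffIntegers ιg) p (Cofree Δ.ρ (padicCoeffField ιg)))]
          [TopologicalSpace (PowerSeries (PowerSeries (padicCoeffIntegers ιg)))]
          [ContinuousSMul (PowerSeries (PowerSeries (padicCoeffIntegers ιg)))
            (BigRepModule (PowerSeries (padicCoeffIntegers ιg)) p
              (BigRepModule (padicCoeffIntegers ιg) p (Cofree Δ.ρ (padicCoeffField ιg))))],
        -- the LOCAL control defect at the strict prime is FINITE: `𝓜^{Γ_{K_𝔭̄}}/T_c 𝓜^{Γ_{K_𝔭̄}}` finite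
        Finite (QuotSMulTop (PowerSeries.X : PowerSeries (PowerSeries (padicCoeffIntegers ιg)))
          ↥((((AnticyclotomicBigGaloisRep κ' (AnticyclotomicBigGaloisRep κ (Δ.cofreeRepOver K))).restrict
            (localMap K (Sum.inl 𝔭bar))).toTopRep).ρ.invariants))) :
    Summit.BirchSwinnertonDyer.BirchSwinnertonDyer.Theses.ErratumRoadFive.ErratumThm23SigmaLe := by
  intro p _ ι M _ k g ιg Δ K _ _ 𝔭 𝔭bar κ γ _ S h1 h2 h3 h4 h5 h6 h7 h8 h9 h10 h11 h12 h13 h14 h15 h16 h17 h18 h19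
    h20 h21 h22 b h23 ΩK Ωp Q h24 h25 _i1 _i2 h26
  by_cases hdec : ∀ a : Cofree Δ.ρ (padicCoeffField ιg),
      (∀ σ : LocalGroup K (Sum.inl 𝔭bar), (Δ.cofreeRepOver K) (localMap K (Sum.inl 𝔭bar) σ) a = a) →
      (∃ j : ℕ, p ^ j • a = 0) → a = 0
  · exact ErratumChainDec.erratumThm23SigmaLe_dec_of_twoVarCore hFW ι g ιg Δ K 𝔭 𝔭bar κ γ S h1 h2 h3 h4 h5 h6 hdec
      h7 h8 h9 h10 h11 h12 h13 h14 h15 h16 h17 h18 h19 h20 h21 h22 b h23 ΩK Ωp Q h24 h25 h26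
  · -- (glob) from irreducibility (tree theorem)
    have hglob := IrrK.noFixedTorsion_of_isResiduallyIrreducible' Δ K h6 h9 h16
    -- a cyclotomic `ℤ_p`-extension with a topological generator; any topology on `Λ_K`
    obtain ⟨κ', hκ'⟩ := Literature.NumberTheory.EllipticCurves.exists_cyclotomicZpExtension_holds K p
    obtain ⟨γ', hγ'⟩ := κ'.surjective (Multiplicative.ofAdd 1)
    haveI : Fact (κ'.IsTopGenerator γ') := ⟨hγ'⟩
    letI : TopologicalSpace (PowerSeries (PowerSeries (padicCoeffIntegers ιg))) := ⊥
    haveI : DiscreteTopology (PowerSeries (PowerSeries (padicCoeffIntegers ιg))) := ⟨rfl⟩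
    -- (unr) and the one-variable finite generation, from the tree
    have hSM' : ∀ w : HeightOneSpectrum (𝓞 K), w ∉ (↑S : Set (HeightOneSpectrum (𝓞 K))) →
        ((M : ℕ) : 𝓞 K) ∉ w.asIdeal := fun w hw hM ↦ hw (Finset.mem_coe.2 (h22 w hM))
    have hunr := OrdinaryNewformDatum.cofreeRepOver_localMap_inr_apply_eq_self Δ (K := K) (↑S) hSM'
    haveI : Module.Finite (PowerSeries (padicCoeffIntegers ιg)) (XBig κ (Δ.cofreeRepOver K) 𝔭bar (↑S)) :=
      SkinnerUrban2014.moduleFinite_XBig_newform Δ (CoeffRing.finiteDimensional_padicCoeffField ιg h1) K κ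
        𝔭bar (↑S) S.finite_toSet hSM'
    -- the local defect is finite (the corner stub S2♭♭), hence FINITE-DEFECT control
    have hfin := hLoc g ιg Δ K 𝔭bar κ γ S h1 h2 h3 h5 h6 h8 h9 h11 h14 h16 h17 h20 h21 h22 hdec κ' γ' hκ'
    haveI := ControlFiniteDefect.module_finite_XBig_iterate_of_finite_defect κ κ' (Δ.cofreeRepOver K) 𝔭bar (↑S)
      hglob hunr hfin
    have key := ControlFiniteDefect.exists_controlMap_of_finite_defect κ κ' (Δ.cofreeRepOver K) 𝔭bar (↑S)
      hglob hunr hfin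
    -- its finite kernel is pseudo-null over `Λ_𝒪`
    letI : _root_.Module (PowerSeries (padicCoeffIntegers ιg))
        (QuotSMulTop (PowerSeries.X : PowerSeries (PowerSeries (padicCoeffIntegers ιg)))
          (XBig κ' (AnticyclotomicBigGaloisRep κ (Δ.cofreeRepOver K)) 𝔭bar (↑S))) :=
      Module.compHom _ (PowerSeries.C (R := PowerSeries (padicCoeffIntegers ιg)))
    haveI : Finite (LinearMap.ker key.choose) := key.choose_spec.2
    have hpn : Literature.NumberTheory.EllipticCurves.Module.IsPseudoNull (PowerSeries (padicCoeffIntegers ιg))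
        (LinearMap.ker key.choose) := isPseudoNull_of_finite_coeffRing ιg h1 _
    -- ring-theoretic clauses for the newform's coefficient ring
    haveI := CoeffRing.finiteDimensional_padicCoeffField ιg h1
    haveI : IsPrincipalIdealRing (padicCoeffIntegers ιg) := CoeffRing.isPrincipalIdealRing ιg
    haveI : UniqueFactorizationMonoid (PowerSeries (PowerSeries (padicCoeffIntegers ιg))) :=
      CoeffRing.uniqueFactorizationMonoid_powerSeries_powerSeries ιg
    -- two-variable torsion from the one-variable torsion premise + control (determinant trick)
    have hs := TwoVariableDescent.exists_constantCoeff_ne_zero_of_control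
      (A := PowerSeries (padicCoeffIntegers ιg))
      (XBig κ' (AnticyclotomicBigGaloisRep κ (Δ.cofreeRepOver K)) 𝔭bar (↑S))
      (XBig κ (Δ.cofreeRepOver K) 𝔭bar (↑S)) h26 key.choose hpn
    have htors₂ := TwoVariableDescent.isTorsion_of_exists_constantCoeff_ne_zero
      (A := PowerSeries (padicCoeffIntegers ιg))
      (XBig κ' (AnticyclotomicBigGaloisRep κ (Δ.cofreeRepOver K)) 𝔭bar (↑S)) hs
    -- the two-variable core (S1), for this cyclotomic `κ'`
    obtain ⟨Q₂, ⟨u, hu⟩, hle⟩ := hFW ι g ιg Δ K 𝔭 𝔭bar κ γ S h1 h2 h3 h4 h5 h6 h7 h8 h9 h10 h11 h12 h13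
      h14 h15 h16 h17 h18 h19 h20 h21 h22 b h23 ΩK Ωp Q h24 h25 κ' γ' hκ' htors₂
    -- descent of the characteristic ideal along `T_c ↦ 0` with PSEUDO-NULL kernel (JSW Cor. 3.4.2, kernel form)
    have hdesc := TwoVariableDescent.charIdeal_le_map_constantCoeff_of_control
      (A := PowerSeries (padicCoeffIntegers ιg))
      (XBig κ' (AnticyclotomicBigGaloisRep κ (Δ.cofreeRepOver K)) 𝔭bar (↑S))
      (XBig κ (Δ.cofreeRepOver K) 𝔭bar (↑S)) h26 key.choose key.choose_spec.1 hpn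
    refine (Ideal.map_mono hdesc).trans ?_
    rw [TwoVariableDescent.map_map_constantCoeff_eq b]
    exact TwoVariableDescent.map_constantCoeff_le_span_of_le_span_of_eq_unit_mul hle hu

end Summit.BirchSwinnertonDyer.BirchSwinnertonDyer.Theorems.ErratumThm23TwoVariable.ErratumChainV4

end
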